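import Summits.BirchSwinnertonDyer.BirchSwinnertonDyer.Theorems.KolyvaginDepthDoorDepthTableKuriharaDecisive664a1
import Summits.BirchSwinnertonDyer.BirchSwinnertonDyer.Theorems.KolyvaginDepthDoorDepthTableKuriharaSocket916c1
import Summits.BirchSwinnertonDyer.BirchSwinnertonDyer.Theorems.KolyvaginDepthDoorDepthTableRow664a1RankDischarged
import HarnessLib

/-!
# Route `KolyvaginDepthDoor`, crux `KolyvaginDepthSupplyKN` (stmt-BirchSwinnertonDyer-22820) —
# DEPTH TABLE v20, ROW `664a1` @ `(11, d_K = -39)` (SPLIT CELL): the EXACT depth-one reading at `11` and g23's decisive prime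
# `1607` UPGRADED to an IFF («bit ⟺ unit `δ̃_1607(T₀)`»)

Helper file of the lead prover of line `levelone` (kdd-p1 g24; `--supports stmt-BirchSwinnertonDyer-22820
--as helper`); it closes nothing and BSD is NOT proved by it.

v19 (g23) corrected this row's prime to `11` (`7` is inert in `ℚ(√-39)`; the split cell needs `p` split), rebuilt the E-side at `11`
(`…KuriharaSocket664a1`: `Ш(664a1)[11] = 0` from the record `cert_664a1` @ `(11, 463·1013)`) and named the decisive prime `1607`
of the twist model `T₀ = [0, 0, 0, -10647, -593190]` for the integral point `P = (133, 586)` — but only in SELMER-BOUND form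
(`…KuriharaDecisive664a1`: `#Sel_11(E^{(-39)}) ≤ 11 ⟹ unit at 1607`), «no exact row at 11». The exact row IS assemblable from the
tree: `rank 664a1 = 2` is a kernel theorem (`Rank2Observatory.C664a1.mordellWeilRank_eq_two`), `ρ̄_{E,11}` onto (Serre Prop. 19,
g23) lifts to the tower by Serre (`serre_hasSurjectiveModNGaloisRep_pow_holds`), Kodaira–Néron at `11` is `C664a1.kodairaNeron_of_five_le`,
`11` splits in `K` (`(-39/11) = 1`, the public `satisfiesHeegnerHypothesis_prime_of_jacobiSym` of `…KuriharaSocket916c1`), so the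
split-cell generic `kolyvaginClass_prime_ne_zero_iff_rankTwo_shaTrivial_twistSelmer_of_maninPrint` ((γ), Castella–Sano Thm. 3,
Zanarella 2.18, Howard–Zanarella, modularity, Mazur BY NAME) gives the exact row at `(11, -39)` exactly as g14/g20 did at `5`. HENCE

* `exactRow_11_neg39` / `exactRow_11_neg39_rankFree` — the split-cell exact row of `664a1` at `(11, -39)`:
  bit ⟺ «(`rank = 2` ∧) `Ш(E)[11] = 0` ∧ `#Sel_11(E^{(-39)}) ≤ 11`».
* `kolyvaginPrime_iff_twistKuriharaBit_11_neg39` — **THE EXACT DEPTH-ONE READING** in Kurihara currency (∘ the E-side claim and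
  v18's twist IFF): bit ⟺ «for every admissible datum of `T₀`, some cyclic Kolyvagin level of `(T₀, 11)` of depth `≤ 1` carries a
  unit mod-`11` Kurihara number».
* `twistKuriharaBit_iff_unit_1607` — g23's Selmer-bound decisive prime made TWO-WAY: **bit ⟺ unit `δ̃_1607(T₀)`**.
(The second decisive prime `2267` and the agreement test follow in `…KuriharaDecisive664a1B`.)

CONDITIONAL on the named facts displayed and the E-side record claim `hδE`; per curve; nothing class-wide; BSD is NOT proved by
any of this.

References: [Sakamoto2022pSelmer] Lemma 4.4, Lemma 4.6 (1), Thm. 1.2, Thm. 1.5; [Kim2022StructureSelmer] Thm. 1.11, §1.2.2;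
[CastellaSano2026] Thm. 3; [Zanarella2019] Prop. 2.18; [Howard2004] Lemma 1.6.4; [GrossLMS1991] Prop. 3.7 (2); [Mazur1978]
Cor. 4.1; [Serre1972] Prop. 19, IV.3.4; [Cox2013] Prop. 5.16; [SilvermanAEC2009] III.2.3, VII.2.1, VII.3.1, X.4.2;
[CremonaAlgorithms1997] Table 1 (664a1), §3.6.
-/

set_option linter.dupNamespace false

noncomputable section

open scoped Classical NumberField

namespace Summit.BirchSwinnertonDyer.BirchSwinnertonDyer.Theorems.KolyvaginDepthDoor

open Literature.NumberTheory.EllipticCurves Literature.NumberTheory.EllipticCurves.ModularForms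
  WeierstrassCurve NumberField IsDedekindDomain
open Summit.BirchSwinnertonDyer.BirchSwinnertonDyer.Theorems
open Summit.BirchSwinnertonDyer.BirchSwinnertonDyer.Rank2Observatory
open Summit.BirchSwinnertonDyer.BirchSwinnertonDyer.Rank1Residual (IntModel.frobeniusTrace_eq)
open Summit.BirchSwinnertonDyer.Rank1Residual.Supersingular (natCard_point_eq_of_countPoints countPoints_eq_of_fast)
open Summit.BirchSwinnertonDyer.Rank1Residual.Additive (card_torsion_le_of_intModel_of_card
  isKolyvaginPrime_of_intModel_of_card)

namespace C664a1

/-! ## §1 The exact row of `664a1` at `(11, -39)` and its Kurihara reading -/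

/-- **DEPTH-TABLE ROW `664a1`, `(p, d_K) = (11, −39)`, READ EXACTLY on the split (Castella–Sano) cell.** For `E = 664a1`
(`[0, 0, 0, -7, 10]`, `N = 2³·83`, non-CM, two independent points `KernelCerts001.C664a1.two_le_rank`) and ANY imaginary quadratic
`K` with `d_K = −39` (`11` split, `d_K` odd): «some frame, some Kolyvagin prime `ℓ`, some datum of conductor `ℓ` with `c_1(ℓ) ≠ 0`»
`↔` «`rank E = 2` ∧ `Ш(E)[11] = 0` ∧ `#Sel_11(E^{(−39)}) ≤ 11`». Side conditions all kernel: `11` good ordinary (`a_11 = −3`),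
`ρ̄_{E,11^n}` onto (Serre Prop. 19 at `11`, g23, + Serre IV.3.4), Kodaira–Néron at `11`, Heegner hypothesis for `664` in `K`.
CONDITIONAL on (γ), Castella–Sano Thm. 3, Zanarella 2.18, Howard–Zanarella, modularity and Mazur Cor. 4.1 by name; per curve; BSD
is not proved by it. [cite: CastellaSano2026, Thm. 3] [cite: Zanarella2019, Prop. 2.18] [cite: Howard2004, Lemma 1.6.4]
[cite: Mazur1978, Cor. 4.1] [cite: GrossLMS1991, Prop. 3.7 (2)] [cite: CremonaAlgorithms1997, Table 1 (664a1)] -/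
theorem exactRow_11_neg39
    (h372 : GrossLMS1991.prop37_2_frobeniusCongruence)
    (h3 : Literature.NumberTheory.EllipticCurves.CastellaSano2026_kolyvaginClass_selmerDivisibility_eq_padicValNat_tamagawaProduct)
    (hZ : Literature.NumberTheory.EllipticCurves.Zanarella2019_kolyvaginClass_one_ne_zero_of_not_selmerDivisible)
    (hHZ : Literature.NumberTheory.EllipticCurves.HowardZanarella_exists_minimal_kolyvaginClass_one_selmerCard_of_ne_zero)
    (hnf : exists_isNewformOf) (hMaz : mazur_not_dvd_maninConstant_of_odd)
    (K : Type) [Field K] [NumberField K] (hK : IsImaginaryQuadratic K)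
    (hD : NumberField.discr K = -39) :
    haveI := isElliptic_c664a1; haveI := isGloballyMinimal_c664a1;
    haveI : NeZero (((⟨0, 0, 0, -7, 10⟩ : WeierstrassCurve ℤ).map (Int.castRingHom ℚ)).conductorNorm ℤ) := neZero_conductorNorm_of_isElliptic _;
    haveI := Fact.mk (by norm_num : Nat.Prime 11);
    (∃ (Dt : ModularParametrizationData ((⟨0, 0, 0, -7, 10⟩ : WeierstrassCurve ℤ).map (Int.castRingHom ℚ)) (((⟨0, 0, 0, -7, 10⟩ : WeierstrassCurve ℤ).map (Int.castRingHom ℚ)).conductorNorm ℤ)) (β : ℤ)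
      (ι : K →+* ℂ) (ℓ : ℕ) (d : KolyvaginHeegnerData Dt β ι ℓ),
      ℓ.Prime ∧ Zhang2014.IsKolyvaginPrime (((⟨0, 0, 0, -7, 10⟩ : WeierstrassCurve ℤ).map (Int.castRingHom ℚ)).conductorNorm ℤ) ((⟨0, 0, 0, -7, 10⟩ : WeierstrassCurve ℤ).map (Int.castRingHom ℚ)) K 11 ℓ ∧
        d.kolyvaginClass (p := 11) (by norm_num) 1 ≠ 0) ↔
    (((⟨0, 0, 0, -7, 10⟩ : WeierstrassCurve ℤ).map (Int.castRingHom ℚ)).mordellWeilRank = 2 ∧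
      (((⟨0, 0, 0, -7, 10⟩ : WeierstrassCurve ℤ).map (Int.castRingHom ℚ)).sha ⊓ AddSubgroup.torsionBy ((⟨0, 0, 0, -7, 10⟩ : WeierstrassCurve ℤ).map (Int.castRingHom ℚ)).galH1 ((11 : ℕ) : ℤ) : AddSubgroup _) = ⊥ ∧
      Nat.card ((((⟨0, 0, 0, -7, 10⟩ : WeierstrassCurve ℤ).map (Int.castRingHom ℚ)).quadraticTwist (NumberField.discr K : ℚ)).selmerGroup (11 : ℕ)) ≤ 11) := by
  haveI := isElliptic_c664a1
  haveI := isGloballyMinimal_c664a1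
  haveI iNZ : NeZero (((⟨0, 0, 0, -7, 10⟩ : WeierstrassCurve ℤ).map (Int.castRingHom ℚ)).conductorNorm ℤ) :=
    neZero_conductorNorm_of_isElliptic _
  haveI iP := Fact.mk (by norm_num : Nat.Prime 11)
  have hgo := goodOrdinary_11
  have hH := satisfiesHeegnerHypothesis_conductorNorm_of_intModel intModel K hK.1 hD heegner_neg39
  have hKN := kodairaNeron_of_five_le 11 (by norm_num)
  have hodd : Odd (NumberField.discr K) := by rw [hD, Int.odd_iff]; norm_num
  have hD3 : NumberField.discr K ≠ -3 := by rw [hD]; norm_num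
  have hD4 : NumberField.discr K ≠ -4 := by rw [hD]; norm_num
  have hpD : ¬ (((11 : ℕ) : ℤ) ∣ NumberField.discr K) := by rw [hD]; norm_num
  have hspl : SatisfiesHeegnerHypothesis 11 K :=
    satisfiesHeegnerHypothesis_prime_of_jacobiSym K hK.1 hD 11 (by norm_num) (by norm_num) (by norm_num)
  have hsur : ((⟨0, 0, 0, -7, 10⟩ : WeierstrassCurve ℤ).map (Int.castRingHom ℚ)).HasSurjectiveModNGaloisRep ((11 : ℕ) : ℤ) := by
    simpa using hasSurjectiveModNGaloisRep_11
  have htower : ∀ k : ℕ, ((⟨0, 0, 0, -7, 10⟩ : WeierstrassCurve ℤ).map (Int.castRingHom ℚ)).HasSurjectiveModNGaloisRep ((11 : ℕ) ^ k : ℕ) :=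
    serre_hasSurjectiveModNGaloisRep_pow_holds _ 11 (by norm_num) hsur
  exact kolyvaginClass_prime_ne_zero_iff_rankTwo_shaTrivial_twistSelmer_of_maninPrint h372 h3 hZ hHZ hnf
    hMaz _ not_hasCM KernelCerts001.C664a1.two_le_rank 11 (by norm_num) hgo.1 hgo.2 htower hKN
    K hK hodd hD3 hD4 hpD hspl hH

/-- **The exact row of `664a1` at `(11, −39)` with `rank E = 2` discharged** by the kernel 2-descent certificate
`Rank2Observatory.C664a1.mordellWeilRank_eq_two`: bit `↔` «`Ш(E)[11] = 0` ∧ `#Sel_11(E^{(−39)}) ≤ 11`». CONDITIONAL on the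
six named facts; per curve; BSD is not proved by it. [cite: CastellaSano2026, Thm. 3] [cite: Cassels1991LecturesEllipticCurves, §15]
[cite: CremonaAlgorithms1997, Table 1 (664a1), §3.6] -/
theorem exactRow_11_neg39_rankFree
    (h372 : GrossLMS1991.prop37_2_frobeniusCongruence)
    (h3 : Literature.NumberTheory.EllipticCurves.CastellaSano2026_kolyvaginClass_selmerDivisibility_eq_padicValNat_tamagawaProduct)
    (hZ : Literature.NumberTheory.EllipticCurves.Zanarella2019_kolyvaginClass_one_ne_zero_of_not_selmerDivisible)
    (hHZ : Literature.NumberTheory.EllipticCurves.HowardZanarella_exists_minimal_kolyvaginClass_one_selmerCard_of_ne_zero)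
    (hnf : exists_isNewformOf) (hMaz : mazur_not_dvd_maninConstant_of_odd)
    (K : Type) [Field K] [NumberField K] (hK : IsImaginaryQuadratic K)
    (hD : NumberField.discr K = -39) :
    haveI := isElliptic_c664a1; haveI := isGloballyMinimal_c664a1;
    haveI : NeZero (((⟨0, 0, 0, -7, 10⟩ : WeierstrassCurve ℤ).map (Int.castRingHom ℚ)).conductorNorm ℤ) := neZero_conductorNorm_of_isElliptic _;
    haveI := Fact.mk (by norm_num : Nat.Prime 11);
    (∃ (Dt : ModularParametrizationData ((⟨0, 0, 0, -7, 10⟩ : WeierstrassCurve ℤ).map (Int.castRingHom ℚ)) (((⟨0, 0, 0, -7, 10⟩ : WeierstrassCurve ℤ).map (Int.castRingHom ℚ)).conductorNorm ℤ)) (β : ℤ)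
      (ι : K →+* ℂ) (ℓ : ℕ) (d : KolyvaginHeegnerData Dt β ι ℓ),
      ℓ.Prime ∧ Zhang2014.IsKolyvaginPrime (((⟨0, 0, 0, -7, 10⟩ : WeierstrassCurve ℤ).map (Int.castRingHom ℚ)).conductorNorm ℤ) ((⟨0, 0, 0, -7, 10⟩ : WeierstrassCurve ℤ).map (Int.castRingHom ℚ)) K 11 ℓ ∧
        d.kolyvaginClass (p := 11) (by norm_num) 1 ≠ 0) ↔
    ((((⟨0, 0, 0, -7, 10⟩ : WeierstrassCurve ℤ).map (Int.castRingHom ℚ)).sha ⊓ AddSubgroup.torsionBy ((⟨0, 0, 0, -7, 10⟩ : WeierstrassCurve ℤ).map (Int.castRingHom ℚ)).galH1 ((11 : ℕ) : ℤ) : AddSubgroup _) = ⊥ ∧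
      Nat.card ((((⟨0, 0, 0, -7, 10⟩ : WeierstrassCurve ℤ).map (Int.castRingHom ℚ)).quadraticTwist (NumberField.discr K : ℚ)).selmerGroup (11 : ℕ)) ≤ 11) := by
  haveI := isElliptic_c664a1
  haveI := isGloballyMinimal_c664a1
  haveI iNZ : NeZero (((⟨0, 0, 0, -7, 10⟩ : WeierstrassCurve ℤ).map (Int.castRingHom ℚ)).conductorNorm ℤ) :=
    neZero_conductorNorm_of_isElliptic _
  haveI iP := Fact.mk (by norm_num : Nat.Prime 11)
  exact (exactRow_11_neg39 h372 h3 hZ hHZ hnf hMaz K hK hD).trans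
    (and_iff_right Summit.BirchSwinnertonDyer.BirchSwinnertonDyer.Rank2Observatory.C664a1.mordellWeilRank_eq_two)

/-- **THE EXACT DEPTH-ONE READING of row `664a1` @ `(11, −39)` in Kurihara currency** (split cell). Granted the E-side claim
`hδE` (record `cert_664a1` @ `(11, 463·1013)`; with Kim Thm. 1.11 it gives `Ш(664a1)[11] = 0`) and the named facts displayed:
for every `K` with `d_K = −39`, the depth-table bit holds IF AND ONLY IF «for every datum `D` of `T₀ = [0, 0, 0, -10647, -593190]`
at level `N_{T₀}` with `11 ∤ c_D` and the period transfer, some cyclic Kolyvagin level `m` of `(T₀, 11)` with `ν(m) ≤ 1` carries a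
unit mod-`11` Kurihara number» (`exactRow_11_neg39_rankFree` ∘ v18's twist IFF `natCard_selmerGroup_quadraticTwist_le_iff_kuriharaBit`).
CONDITIONAL on the nine named facts and the claim `hδE`; per curve; BSD is not proved by it. [cite: Sakamoto2022pSelmer, Thm. 1.2, Thm. 1.5]
[cite: Kim2022StructureSelmer, Thm. 1.11] [cite: CastellaSano2026, Thm. 3] [cite: CremonaAlgorithms1997, Table 1 (664a1)] -/
theorem kolyvaginPrime_iff_twistKuriharaBit_11_neg39
    (h372 : GrossLMS1991.prop37_2_frobeniusCongruence)
    (h3 : Literature.NumberTheory.EllipticCurves.CastellaSano2026_kolyvaginClass_selmerDivisibility_eq_padicValNat_tamagawaProduct)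
    (hZ : Literature.NumberTheory.EllipticCurves.Zanarella2019_kolyvaginClass_one_ne_zero_of_not_selmerDivisible)
    (hHZ : Literature.NumberTheory.EllipticCurves.HowardZanarella_exists_minimal_kolyvaginClass_one_selmerCard_of_ne_zero)
    (hKim : Kim2022_card_selmerGroup_le_pow_of_kuriharaNumber_ne_zero)
    (hSak1 : Sakamoto2022_card_selmerGroup_eq_pow_of_isDeltaMinimal)
    (hSak2 : Sakamoto2022_exists_cyclicLevel_kuriharaNumber_ne_zero)
    (hnf : exists_isNewformOf) (hMaz : mazur_not_dvd_maninConstant_of_odd)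
    (K : Type) [Field K] [NumberField K] (hK : IsImaginaryQuadratic K) (hD : NumberField.discr K = -39)
    (hδE : haveI := isElliptic_c664a1; haveI := isGloballyMinimal_c664a1;
      haveI : NeZero (((⟨0, 0, 0, -7, 10⟩ : WeierstrassCurve ℤ).map (Int.castRingHom ℚ)).conductorNorm ℤ) := neZero_conductorNorm_of_isElliptic _;
      haveI := Fact.mk (by norm_num : Nat.Prime 11);
      ∀ (D : ModularParametrizationData ((⟨0, 0, 0, -7, 10⟩ : WeierstrassCurve ℤ).map (Int.castRingHom ℚ)) (((⟨0, 0, 0, -7, 10⟩ : WeierstrassCurve ℤ).map (Int.castRingHom ℚ)).conductorNorm ℤ)), ¬ ((11 : ℕ) : ℤ) ∣ D.maninConstant →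
        (∃ u : ℚ, ‖(u : ℚ_[11])‖ = 1 ∧ ((⟨0, 0, 0, -7, 10⟩ : WeierstrassCurve ℤ).map (Int.castRingHom ℚ)).realPeriodRat = u * plusPeriod D.f) →
        ∃ ψ : (ℓ : ℕ) → (ZMod ℓ)ˣ →* Multiplicative (ZMod 11),
          (∀ ℓ ∈ (469019 : ℕ).primeFactors, Function.Surjective (ψ ℓ)) ∧ kuriharaNumber D.f 11 469019 ψ ≠ 0) :
    haveI := isElliptic_c664a1; haveI := isGloballyMinimal_c664a1;
    haveI : NeZero (((⟨0, 0, 0, -7, 10⟩ : WeierstrassCurve ℤ).map (Int.castRingHom ℚ)).conductorNorm ℤ) := neZero_conductorNorm_of_isElliptic _;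
    haveI := minTwist39_isElliptic; haveI := minTwist39_isGloballyMinimal;
    haveI : NeZero (((⟨0, 0, 0, -10647, -593190⟩ : WeierstrassCurve ℤ).map (Int.castRingHom ℚ)).conductorNorm ℤ) := neZero_conductorNorm_of_isElliptic _;
    haveI := Fact.mk (by norm_num : Nat.Prime 11);
    (∃ (Dt : ModularParametrizationData ((⟨0, 0, 0, -7, 10⟩ : WeierstrassCurve ℤ).map (Int.castRingHom ℚ)) (((⟨0, 0, 0, -7, 10⟩ : WeierstrassCurve ℤ).map (Int.castRingHom ℚ)).conductorNorm ℤ)) (β : ℤ)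
      (ι : K →+* ℂ) (ℓ : ℕ) (d : KolyvaginHeegnerData Dt β ι ℓ),
      ℓ.Prime ∧ Zhang2014.IsKolyvaginPrime (((⟨0, 0, 0, -7, 10⟩ : WeierstrassCurve ℤ).map (Int.castRingHom ℚ)).conductorNorm ℤ) ((⟨0, 0, 0, -7, 10⟩ : WeierstrassCurve ℤ).map (Int.castRingHom ℚ)) K 11 ℓ ∧
        d.kolyvaginClass (p := 11) (by norm_num) 1 ≠ 0) ↔
    (∀ (D : ModularParametrizationData ((⟨0, 0, 0, -10647, -593190⟩ : WeierstrassCurve ℤ).map (Int.castRingHom ℚ))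
          (((⟨0, 0, 0, -10647, -593190⟩ : WeierstrassCurve ℤ).map (Int.castRingHom ℚ)).conductorNorm ℤ)),
        ¬ ((11 : ℕ) : ℤ) ∣ D.maninConstant →
        (∃ u : ℚ, ‖(u : ℚ_[11])‖ = 1 ∧
          ((⟨0, 0, 0, -10647, -593190⟩ : WeierstrassCurve ℤ).map (Int.castRingHom ℚ)).realPeriodRat = u * plusPeriod D.f) →
        ∃ (m : ℕ) (_ : NeZero m), IsCyclicKolyvaginLevel ((⟨0, 0, 0, -10647, -593190⟩ : WeierstrassCurve ℤ).map (Int.castRingHom ℚ)) 11 m ∧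
          m.primeFactors.card ≤ 1 ∧
          ∃ ψ : (ℓ : ℕ) → (ZMod ℓ)ˣ →* Multiplicative (ZMod 11),
            (∀ ℓ ∈ m.primeFactors, Function.Surjective (ψ ℓ)) ∧ kuriharaNumber D.f 11 m ψ ≠ 0) := by
  haveI := isElliptic_c664a1
  haveI := isGloballyMinimal_c664a1
  haveI iNZ : NeZero (((⟨0, 0, 0, -7, 10⟩ : WeierstrassCurve ℤ).map (Int.castRingHom ℚ)).conductorNorm ℤ) :=
    neZero_conductorNorm_of_isElliptic _
  haveI := minTwist39_isElliptic
  haveI := minTwist39_isGloballyMinimal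
  haveI iNZT : NeZero (((⟨0, 0, 0, -10647, -593190⟩ : WeierstrassCurve ℤ).map (Int.castRingHom ℚ)).conductorNorm ℤ) :=
    neZero_conductorNorm_of_isElliptic _
  haveI iP := Fact.mk (by norm_num : Nat.Prime 11)
  have hsha := sha_inf_torsionBy_eq_bot_of_kuriharaClaim_11 hKim hnf hMaz hδE
  have hsur : ((⟨0, 0, 0, -7, 10⟩ : WeierstrassCurve ℤ).map (Int.castRingHom ℚ)).HasSurjectiveModNGaloisRep ((11 : ℕ) : ℤ) := by
    simpa using hasSurjectiveModNGaloisRep_11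
  have hpD : ¬ (((11 : ℕ) : ℤ) ∣ NumberField.discr K) := by rw [hD]; decide
  have hC : (⟨1, (0 : ℚ), (0 : ℚ), (0 : ℚ)⟩ : WeierstrassCurve.VariableChange ℚ) • ((⟨0, 0, 0, -10647, -593190⟩ : WeierstrassCurve ℤ).map (Int.castRingHom ℚ)) =
      ((⟨0, 0, 0, -7, 10⟩ : WeierstrassCurve ℤ).map (Int.castRingHom ℚ)).quadraticTwist ((NumberField.discr K : ℤ) : ℚ) := by
    rw [hD]; push_cast; exact minTwist39_smul_eq
  have hT := natCard_selmerGroup_quadraticTwist_le_iff_kuriharaBit hKim hSak1 hSak2 hnf hMaz _ 11 (by norm_num) goodOrdinary_11.1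
    goodOrdinary_11.2 hsur (NumberField.discr_ne_zero K) hpD _ _ hC minTwist39_nonAnomalous_11 minTwist39_kodairaNeron_11 1
  rw [pow_one] at hT
  rw [exactRow_11_neg39_rankFree h372 h3 hZ hHZ hnf hMaz K hK hD, and_iff_right hsha]
  exact hT

/-! ## §2 The decisive prime `1607` (g23's kernel certificate), now two-way -/

/-- **ROW `664a1` @ `(11, -39)`: THE DECISIVE PRIME `1607` — bit ⟺ unit `δ̃_1607(T₀)`** (exact form; the kernel lemmas `minTwist39_isCyclicKolyvaginLevel_11_1607`, `minTwist39_localNondivisible_1607` are g23's, `…KuriharaDecisive664a1`). For every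
imaginary quadratic `K` with `d_K = -39`, granted the named facts displayed and the E-side record claim `hδE`: the depth-table
bit holds IF AND ONLY IF «every datum `D` of `T₀` at level `N_{T₀}` with `11 ∤ c_D` and the period transfer has a UNIT mod-`11`
Kurihara number AT `1607`» — the claim of a future tree record `cert_<T₀>` @ `(11, 1607)`. (⟹): bit ⟹ `#Sel_11(E^{(-39)}) ≤ 11`
(§1) ⟹ unit at `1607` (`twistKuriharaClaim_prime_of_natCard_selmerGroup_le`, kernel certificate `minTwist39_localNondivisible_1607`);
(⟸): §1 with `m = 1607` (`ν(1607) = 1`). CONDITIONAL on the named facts and the claim; per curve; BSD is not proved by it.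
[cite: Sakamoto2022pSelmer, Lemma 4.4, Lemma 4.6 (1), Thm. 1.2, Thm. 1.5] [cite: Kim2022StructureSelmer, Thm. 1.11]
[cite: CastellaSano2026, Thm. 3] [cite: CremonaAlgorithms1997, Table 1 (664a1)] -/
theorem twistKuriharaBit_iff_unit_1607
    (h372 : GrossLMS1991.prop37_2_frobeniusCongruence)
    (h3 : Literature.NumberTheory.EllipticCurves.CastellaSano2026_kolyvaginClass_selmerDivisibility_eq_padicValNat_tamagawaProduct)
    (hZ : Literature.NumberTheory.EllipticCurves.Zanarella2019_kolyvaginClass_one_ne_zero_of_not_selmerDivisible)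
    (hHZ : Literature.NumberTheory.EllipticCurves.HowardZanarella_exists_minimal_kolyvaginClass_one_selmerCard_of_ne_zero)
    (hKim : Kim2022_card_selmerGroup_le_pow_of_kuriharaNumber_ne_zero)
    (hSak1 : Sakamoto2022_card_selmerGroup_eq_pow_of_isDeltaMinimal)
    (hSak2 : Sakamoto2022_exists_cyclicLevel_kuriharaNumber_ne_zero)
    (hSak3 : Literature.NumberTheory.EllipticCurves.Sakamoto2022_kuriharaNumber_prime_ne_zero_of_localNondivisible)
    (hnf : exists_isNewformOf) (hMaz : mazur_not_dvd_maninConstant_of_odd)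
    (K : Type) [Field K] [NumberField K] (hK : IsImaginaryQuadratic K) (hD : NumberField.discr K = -39)
    (hδE : haveI := isElliptic_c664a1; haveI := isGloballyMinimal_c664a1;
      haveI : NeZero (((⟨0, 0, 0, -7, 10⟩ : WeierstrassCurve ℤ).map (Int.castRingHom ℚ)).conductorNorm ℤ) := neZero_conductorNorm_of_isElliptic _;
      haveI := Fact.mk (by norm_num : Nat.Prime 11);
      ∀ (D : ModularParametrizationData ((⟨0, 0, 0, -7, 10⟩ : WeierstrassCurve ℤ).map (Int.castRingHom ℚ)) (((⟨0, 0, 0, -7, 10⟩ : WeierstrassCurve ℤ).map (Int.castRingHom ℚ)).conductorNorm ℤ)), ¬ ((11 : ℕ) : ℤ) ∣ D.maninConstant →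
        (∃ u : ℚ, ‖(u : ℚ_[11])‖ = 1 ∧ ((⟨0, 0, 0, -7, 10⟩ : WeierstrassCurve ℤ).map (Int.castRingHom ℚ)).realPeriodRat = u * plusPeriod D.f) →
        ∃ ψ : (ℓ : ℕ) → (ZMod ℓ)ˣ →* Multiplicative (ZMod 11),
          (∀ ℓ ∈ (469019 : ℕ).primeFactors, Function.Surjective (ψ ℓ)) ∧ kuriharaNumber D.f 11 469019 ψ ≠ 0) :
    haveI := isElliptic_c664a1; haveI := isGloballyMinimal_c664a1;
    haveI : NeZero (((⟨0, 0, 0, -7, 10⟩ : WeierstrassCurve ℤ).map (Int.castRingHom ℚ)).conductorNorm ℤ) := neZero_conductorNorm_of_isElliptic _;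
    haveI := minTwist39_isElliptic; haveI := minTwist39_isGloballyMinimal;
    haveI : NeZero (((⟨0, 0, 0, -10647, -593190⟩ : WeierstrassCurve ℤ).map (Int.castRingHom ℚ)).conductorNorm ℤ) := neZero_conductorNorm_of_isElliptic _;
    haveI := Fact.mk (by norm_num : Nat.Prime 11);
    (∃ (Dt : ModularParametrizationData ((⟨0, 0, 0, -7, 10⟩ : WeierstrassCurve ℤ).map (Int.castRingHom ℚ)) (((⟨0, 0, 0, -7, 10⟩ : WeierstrassCurve ℤ).map (Int.castRingHom ℚ)).conductorNorm ℤ)) (β : ℤ)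
      (ι : K →+* ℂ) (ℓ : ℕ) (d : KolyvaginHeegnerData Dt β ι ℓ),
      ℓ.Prime ∧ Zhang2014.IsKolyvaginPrime (((⟨0, 0, 0, -7, 10⟩ : WeierstrassCurve ℤ).map (Int.castRingHom ℚ)).conductorNorm ℤ) ((⟨0, 0, 0, -7, 10⟩ : WeierstrassCurve ℤ).map (Int.castRingHom ℚ)) K 11 ℓ ∧
        d.kolyvaginClass (p := 11) (by norm_num) 1 ≠ 0) ↔
    (∀ (D : ModularParametrizationData ((⟨0, 0, 0, -10647, -593190⟩ : WeierstrassCurve ℤ).map (Int.castRingHom ℚ))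
          (((⟨0, 0, 0, -10647, -593190⟩ : WeierstrassCurve ℤ).map (Int.castRingHom ℚ)).conductorNorm ℤ)),
        ¬ ((11 : ℕ) : ℤ) ∣ D.maninConstant →
        (∃ u : ℚ, ‖(u : ℚ_[11])‖ = 1 ∧
          ((⟨0, 0, 0, -10647, -593190⟩ : WeierstrassCurve ℤ).map (Int.castRingHom ℚ)).realPeriodRat = u * plusPeriod D.f) →
        ∃ ψ : (q : ℕ) → (ZMod q)ˣ →* Multiplicative (ZMod 11),
          (∀ q ∈ (1607 : ℕ).primeFactors, Function.Surjective (ψ q)) ∧ kuriharaNumber D.f 11 1607 ψ ≠ 0) := by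
  haveI := isElliptic_c664a1
  haveI := isGloballyMinimal_c664a1
  haveI iNZ : NeZero (((⟨0, 0, 0, -7, 10⟩ : WeierstrassCurve ℤ).map (Int.castRingHom ℚ)).conductorNorm ℤ) :=
    neZero_conductorNorm_of_isElliptic _
  haveI := minTwist39_isElliptic
  haveI := minTwist39_isGloballyMinimal
  haveI iNZT : NeZero (((⟨0, 0, 0, -10647, -593190⟩ : WeierstrassCurve ℤ).map (Int.castRingHom ℚ)).conductorNorm ℤ) :=
    neZero_conductorNorm_of_isElliptic _
  haveI iP := Fact.mk (by norm_num : Nat.Prime 11)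
  haveI : Fact (Nat.Prime 1607) := ⟨by norm_num⟩
  haveI : NeZero (1607 : ℕ) := ⟨by norm_num⟩
  have hsur : ((⟨0, 0, 0, -7, 10⟩ : WeierstrassCurve ℤ).map (Int.castRingHom ℚ)).HasSurjectiveModNGaloisRep ((11 : ℕ) : ℤ) := by
    simpa using hasSurjectiveModNGaloisRep_11
  have hpD : ¬ (((11 : ℕ) : ℤ) ∣ NumberField.discr K) := by rw [hD]; decide
  have hC : (⟨1, (0 : ℚ), (0 : ℚ), (0 : ℚ)⟩ : WeierstrassCurve.VariableChange ℚ) • ((⟨0, 0, 0, -10647, -593190⟩ : WeierstrassCurve ℤ).map (Int.castRingHom ℚ)) =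
      ((⟨0, 0, 0, -7, 10⟩ : WeierstrassCurve ℤ).map (Int.castRingHom ℚ)).quadraticTwist ((NumberField.discr K : ℤ) : ℚ) := by
    rw [hD]; push_cast; exact minTwist39_smul_eq
  have hiff := kolyvaginPrime_iff_twistKuriharaBit_11_neg39 h372 h3 hZ hHZ hKim hSak1 hSak2 hnf hMaz K hK hD hδE
  constructor
  · intro hbit D hc hu
    have hT := (natCard_selmerGroup_quadraticTwist_le_iff_kuriharaBit hKim hSak1 hSak2 hnf hMaz _ 11 (by norm_num) goodOrdinary_11.1
      goodOrdinary_11.2 hsur (NumberField.discr_ne_zero K) hpD _ _ hC minTwist39_nonAnomalous_11 minTwist39_kodairaNeron_11 1).mpr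
      (hiff.mp hbit)
    rw [pow_one] at hT
    exact twistKuriharaClaim_prime_of_natCard_selmerGroup_le hSak3 _ 11 (by norm_num) goodOrdinary_11.1 goodOrdinary_11.2 hsur
      (NumberField.discr_ne_zero K) hpD _ _ hC minTwist39_nonAnomalous_11 minTwist39_kodairaNeron_11 hT 1607
      minTwist39_isCyclicKolyvaginLevel_11_1607 _ minTwist39_localNondivisible_1607 D hc hu
  · intro hunit
    refine hiff.mpr fun D hc hu ↦ ?_
    obtain ⟨ψ, hψ, hne⟩ := hunit D hc hu
    refine ⟨1607, inferInstance, minTwist39_isCyclicKolyvaginLevel_11_1607, ?_, ψ, hψ, hne⟩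
    rw [Nat.Prime.primeFactors (by norm_num), Finset.card_singleton]

end C664a1

end Summit.BirchSwinnertonDyer.BirchSwinnertonDyer.Theorems.KolyvaginDepthDoor

end
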